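import Literature.AlgebraicGeometry.Motives.BaseChange
import HarnessLib

/-!
# Points with values in an `L`-algebra: `Hom_K(Spec S, X) = Hom_L(Spec S, X_L)`, in relation form

Layer `Literature/AlgebraicGeometry/Motives`, namespace `Literature.AlgebraicGeometry.Motives`.  THEOREMS ONLY (no
definition, no named fact, no instance).  Generic glue over ★ `Motives/BaseChange` (`baseChangeHom σ`, `baseChangeHomFst`,
`AlgPoints.baseChangeEquiv`).

For a tower of commutative rings `K → L → S` (`[IsScalarTower K L S]`) and a `K`-scheme `X`, write `X_L :=
(baseChangeHom (algebraMap K L)).obj X = X ×_{Spec K} Spec L` and `π : X_L → X` for the first projection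
(`baseChangeHomFst`).  The universal property of the fibre product ([Hartshorne1977] II Thm. 3.3; [GortzWedhorn2020] (4.7)
«`Hom_S(T, X) = Hom_{S'}(T, X_{S'})` for an `S'`-scheme `T`, functorial in `T` and in `X`»; Mathlib `Over.mapPullbackAdj`)
says that `K`-morphisms `f : Spec S → X` and `L`-morphisms `t : Spec S → X_L` correspond bijectively, `t ↦ f` being
«compose with `π`».  We state this WITHOUT introducing the bijection as a definition, through the relation

  `t` lies over `f`  :⟺  `t.left ≫ π = f.left`,

so that consumers can quantify over both sides:
* `exists_unique_lift_of_tower` — every `f` has exactly one `t` over it (Mathlib `pullback.lift` / `pullback.hom_ext`);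
* `exists_unique_descend_of_tower` — every `t` lies over exactly one `f`;
* `left_comp_fst_injective_of_tower` — `t` is determined by `t.left ≫ π`;
* `comp_left_comp_fst_of_tower` — NATURALITY in the test algebra: if `t` lies over `f` and `u : Spec S' → Spec S` is a
  morphism given on both sides by the same scheme map (`u.left = u'.left`), then `u ≫ t` lies over `u' ≫ f`;
* `comp_eq_iff_comp_eq_of_tower` — the POINTED form: for base points `x` over `x₀`, `ι ≫ t = x ↔ ι' ≫ f = x₀`;
* `eq_baseChangeEquiv_iff_left_comp_fst` — for FIELDS and `S = L` the ★ bijection `AlgPoints.baseChangeEquiv` is this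
  correspondence: `x = baseChangeEquiv x₀ ↔ x.left ≫ π = x₀.left`.

The tree already holds the bijection as a DEFINITION in two special cases — ★ `AlgPoints.baseChangeEquiv σ X` (`S = L` a
field) and ★ `AbelianVariety.pointsEquivOfTower` (any `L`-algebra `S`, but `X` an abelian variety) — this file is the
definition-free general case both instantiate.  Cell `hodgecm-mathlib` (D-0151), `B-plan/F-census/SOCKETS-F.md` §4 (α) node
E1-mod (L4) «the ℚ/ℂ adjunction line» (census `B-provers/B-p19/F-census/E-census-E1mod.B-p19g11.md`): consumed by
`ModuliOfAbelianVarieties/SiegelFineModuliDeformationBridgeComplex` to read `ℂ`-algebra-valued points of `𝒜_{g,δ,N} ⊗ ℂ`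
as triples over `Spec R`.  Presearch: [GortzWedhorn2020, (4.7)], [Hartshorne1977, II Thm. 3.3 / Ex. 2.7] (held); tree `rg
'pointsEquivOfTower|baseChangeEquiv'` = the two special cases above.  HC_CM is proved only modulo the 7 printed citations
until rung 0 closes — this file asserts nothing about HC.

## References
* [Hartshorne1977] R. Hartshorne, *Algebraic Geometry* (1977), II §3 Theorem 3.3 (fibre products), II Exercise 2.7.
* [GortzWedhorn2020] U. Görtz, T. Wedhorn, *Algebraic Geometry I* (2nd ed. 2020), Section (4.7) (base change,
  `Hom_S(T, X) = Hom_{S'}(T, X_{S'})`), Remark 6.12 (1).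
-/

set_option autoImplicit false

noncomputable section

universe u

open CategoryTheory CategoryTheory.Limits AlgebraicGeometry

namespace Literature.AlgebraicGeometry.Motives

section Tower

variable {K L : Type u} [CommRing K] [CommRing L] [Algebra K L]
  (S : Type u) [CommRing S] [Algebra K S] [Algebra L S] [IsScalarTower K L S] (X : SchemeOver K)

/-- In a tower `K → L → S`, the structure map `Spec S → Spec K` factors as `Spec S → Spec L → Spec K`.
[cite: GortzWedhorn2020, Section (4.7)] -/
theorem specOver_hom_eq_comp_of_tower :
    (specOver K S).hom = (specOver L S).hom ≫ Spec.map (CommRingCat.ofHom (algebraMap K L)) := by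
  change Spec.map (CommRingCat.ofHom (algebraMap K S)) =
    Spec.map (CommRingCat.ofHom (algebraMap L S)) ≫ Spec.map (CommRingCat.ofHom (algebraMap K L))
  rw [← Spec.map_comp, ← CommRingCat.ofHom_comp, ← IsScalarTower.algebraMap_eq K L S]

variable {S X}

/-- **Existence and uniqueness of the lift** (`Hom_K(Spec S, X) → Hom_L(Spec S, X_L)` is well defined and injective on
fibres of «compose with `π`»): every `K`-morphism `f : Spec S → X` from an `L`-algebra `S` has exactly one `L`-morphism
`t : Spec S → X_L` over it, `t.left ≫ π = f.left` — the universal property of `X_L = X ×_{Spec K} Spec L`.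
[cite: Hartshorne1977, II §3 Theorem 3.3] [cite: GortzWedhorn2020, Section (4.7)] -/
theorem exists_unique_lift_of_tower (f : specOver K S ⟶ X) :
    ∃! t : specOver L S ⟶ (baseChangeHom (algebraMap K L)).obj X,
      t.left ≫ baseChangeHomFst (algebraMap K L) X = f.left := by
  have w : f.left ≫ X.hom = (specOver L S).hom ≫ Spec.map (CommRingCat.ofHom (algebraMap K L)) := by
    rw [← specOver_hom_eq_comp_of_tower (K := K) (L := L) S]
    exact Over.w f
  refine ⟨Over.homMk (pullback.lift f.left (specOver L S).hom w) (pullback.lift_snd _ _ _),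
    pullback.lift_fst _ _ _, fun t ht => ?_⟩
  apply Over.OverMorphism.ext
  apply pullback.hom_ext
  · exact ht.trans (pullback.lift_fst _ _ _).symm
  · exact (Over.w t).trans (pullback.lift_snd _ _ _).symm

/-- **Existence and uniqueness of the descent**: every `L`-morphism `t : Spec S → X_L` lies over exactly one `K`-morphism
`f : Spec S → X`, namely `π ∘ t` (the structure maps match because `π`, the second projection and `Spec L → Spec K` form
the defining square of `X_L`). [cite: Hartshorne1977, II §3 Theorem 3.3] [cite: GortzWedhorn2020, Section (4.7)] -/
theorem exists_unique_descend_of_tower (t : specOver L S ⟶ (baseChangeHom (algebraMap K L)).obj X) :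
    ∃! f : specOver K S ⟶ X, t.left ≫ baseChangeHomFst (algebraMap K L) X = f.left := by
  refine ⟨Over.homMk (t.left ≫ baseChangeHomFst (algebraMap K L) X) ?_, rfl,
    fun f hf => Over.OverMorphism.ext hf.symm⟩
  -- `(t ≫ π) ≫ (X → Spec K) = t ≫ pr₂ ≫ (Spec L → Spec K) = (Spec S → Spec L) ≫ (Spec L → Spec K) = (Spec S → Spec K)`
  have h2 : baseChangeHomFst (algebraMap K L) X ≫ X.hom =
      ((baseChangeHom (algebraMap K L)).obj X).hom ≫ Spec.map (CommRingCat.ofHom (algebraMap K L)) :=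
    pullback.condition
  have h3 : (t.left ≫ baseChangeHomFst (algebraMap K L) X) ≫ X.hom =
      (specOver L S).hom ≫ Spec.map (CommRingCat.ofHom (algebraMap K L)) := by
    rw [Category.assoc, h2, ← Category.assoc, Over.w t]
  exact h3.trans (specOver_hom_eq_comp_of_tower (K := K) (L := L) S).symm

/-- **An `L`-morphism `Spec S → X_L` is determined by its composite with `π : X_L → X`** (uniqueness half of the
universal property). [cite: Hartshorne1977, II §3 Theorem 3.3] -/
theorem left_comp_fst_injective_of_tower :
    Function.Injective fun t : specOver L S ⟶ (baseChangeHom (algebraMap K L)).obj X =>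
      t.left ≫ baseChangeHomFst (algebraMap K L) X := by
  intro t t' h
  dsimp only at h
  obtain ⟨f, hf, -⟩ := exists_unique_descend_of_tower t'
  obtain ⟨t₀, -, huniq⟩ := exists_unique_lift_of_tower (L := L) f
  exact (huniq t (h.trans hf)).trans (huniq t' hf).symm

variable {S' : Type u} [CommRing S'] [Algebra K S'] [Algebra L S']

omit [IsScalarTower K L S] in
/-- **Naturality in the test algebra** («functorial in `T`»): if `t` lies over `f` and `u : Spec S' → Spec S` is given
by the same scheme morphism on the `L`-side and on the `K`-side (`u.left = u'.left`; e.g. `Spec φ` of an `L`-algebra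
map `φ : S → S'` read over `L` and over `K`), then `u ≫ t` lies over `u' ≫ f`.
[cite: GortzWedhorn2020, Section (4.7)] -/
theorem comp_left_comp_fst_of_tower {u : specOver L S' ⟶ specOver L S} {u' : specOver K S' ⟶ specOver K S}
    (hu : u.left = u'.left) {t : specOver L S ⟶ (baseChangeHom (algebraMap K L)).obj X} {f : specOver K S ⟶ X}
    (h : t.left ≫ baseChangeHomFst (algebraMap K L) X = f.left) :
    (u ≫ t).left ≫ baseChangeHomFst (algebraMap K L) X = (u' ≫ f).left :=
  (Category.assoc _ _ _).trans (congrArg₂ (· ≫ ·) hu h)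

omit [IsScalarTower K L S] in
/-- **The pointed form**: let `t : Spec S → X_L` lie over `f : Spec S → X` and let the base points `x : Spec S' → X_L`,
`x₀ : Spec S' → X` correspond (`x.left ≫ π = x₀.left`; typically `S' = L` and `x = baseChangeEquiv x₀`); then for a
base-point inclusion `ι : Spec S' → Spec S` read on both sides (`ι.left = ι'.left`), `t` passes through `x` iff `f`
passes through `x₀`. [cite: GortzWedhorn2020, Section (4.7)] [cite: Hartshorne1977, II §3 Theorem 3.3] -/
theorem comp_eq_iff_comp_eq_of_tower [IsScalarTower K L S'] {ι : specOver L S' ⟶ specOver L S}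
    {ι' : specOver K S' ⟶ specOver K S} (hι : ι.left = ι'.left)
    {t : specOver L S ⟶ (baseChangeHom (algebraMap K L)).obj X} {f : specOver K S ⟶ X}
    (h : t.left ≫ baseChangeHomFst (algebraMap K L) X = f.left)
    {x : specOver L S' ⟶ (baseChangeHom (algebraMap K L)).obj X} {x₀ : specOver K S' ⟶ X}
    (hx : x.left ≫ baseChangeHomFst (algebraMap K L) X = x₀.left) :
    ι ≫ t = x ↔ ι' ≫ f = x₀ := by
  constructor
  · intro he
    exact Over.OverMorphism.ext <| ((comp_left_comp_fst_of_tower hι h).symm.trans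
      (congrArg (fun k : specOver L S' ⟶ (baseChangeHom (algebraMap K L)).obj X =>
        k.left ≫ baseChangeHomFst (algebraMap K L) X) he)).trans hx
  · intro he
    exact left_comp_fst_injective_of_tower (K := K) (L := L) (S := S') (X := X) <|
      ((comp_left_comp_fst_of_tower hι h).trans (congrArg (fun k : specOver K S' ⟶ X => k.left) he)).trans hx.symm

end Tower

section Field

variable {K L : Type u} [Field K] [Field L] [Algebra K L] {X : SchemeOver K}

/-- **The ★ bijection `X(L) ≃ X_L(L)` is this correspondence** (fields, `S = L`): an `L`-point `x` of `X_L` is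
`AlgPoints.baseChangeEquiv (algebraMap K L) X x₀` iff it lies over `x₀`, i.e. `x.left ≫ π = x₀.left`
(★ `AlgPoints.baseChangeEquiv_apply_left_comp_fst` and uniqueness of lifts). [cite: Hartshorne1977, II §3 Theorem 3.3] -/
theorem eq_baseChangeEquiv_iff_left_comp_fst (x₀ : AlgPoints X L)
    (x : AlgPoints ((baseChangeHom (algebraMap K L)).obj X) L) :
    x = AlgPoints.baseChangeEquiv (algebraMap K L) X x₀ ↔
      x.left ≫ baseChangeHomFst (algebraMap K L) X = x₀.left := by
  constructor
  · rintro rfl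
    exact AlgPoints.baseChangeEquiv_apply_left_comp_fst (algebraMap K L) X x₀
  · intro h
    exact left_comp_fst_injective_of_tower (K := K) (L := L) (S := L) (X := X) <|
      h.trans (AlgPoints.baseChangeEquiv_apply_left_comp_fst (algebraMap K L) X x₀).symm

/-- **Every `L`-point of `X_L` is `baseChangeEquiv` of the `K`-side point it lies over** (surjectivity of the ★
bijection, read through the relation). [cite: Hartshorne1977, II §3 Theorem 3.3] -/
theorem exists_eq_baseChangeEquiv (x : AlgPoints ((baseChangeHom (algebraMap K L)).obj X) L) :
    ∃ x₀ : AlgPoints X L, x.left ≫ baseChangeHomFst (algebraMap K L) X = x₀.left ∧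
      x = AlgPoints.baseChangeEquiv (algebraMap K L) X x₀ := by
  obtain ⟨x₀, h, -⟩ := exists_unique_descend_of_tower (K := K) (L := L) (S := L) x
  exact ⟨x₀, h, (eq_baseChangeEquiv_iff_left_comp_fst x₀ x).2 h⟩

end Field

end Literature.AlgebraicGeometry.Motives

end
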